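import Literature.AnabelianGeometry.EtaleTheta.Discharge.Sec2CyclotomicRigidityProofs
import Literature.AnabelianGeometry.EtaleTheta.ThetaSystems

/-!
# [EtTh] §2 discharge: Corollary 2.19 (i) with the Cor 2.18 (iii) inputs replaced by temp-slimness

Mochizuki, *The Étale Theta Function and its Frobenioid-theoretic Manifestations* [EtTh],
Publ. RIMS 45 (2009), §2, Cor 2.19 (i) p.64, Cor 2.18 (iii) p.61, Prop 2.11 (ii) p.44 (locators
`p.N` = PDF pages of the PRIMS text; bib key `MochizukiEtTh2009`). PROOF-ONLY companion (no `def`;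
seat abc-iut-L2-d1, DAG node `EtTh:Cor2.19(i)`): both Cor 2.18 (iii) hypotheses of
`RigidData.cor219_i_subquotients_of` / `cor219_i_splittings_of` (`Cor218_iii_quotient`,
`Cor218_iii_PiX`) follow from temp-slimness of `Π^tp_X` ("every open subgroup has trivial
centraliser", [SemiAnbd] Ex. 3.10) via t2's `centralizerUnion_cycEnvelope_eq` (Prop 2.11 (ii)).
HONEST FRAMING: conditional discharge; no side is taken on [IUTchIII] Cor 3.12; typed ≠ discharged
elsewhere.
-/

namespace Literature.AnabelianGeometry.EtaleTheta

universe u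

namespace RigidData

variable {N : ℕ+} {l : ℕ} (R : RigidData.{u} N l)

/-- Temp-slimness of `Π^tp_X` yields `Cor218_iii_PiX` and `Cor218_iii_quotient`.
[cite: MochizukiEtTh2009, Cor 2.18(iii) p.61] -/
theorem cor218_iii_of_tempSlim
    (hts : ∀ U : Subgroup R.PiX, IsOpen (U : Set R.PiX) →
      ∀ z : R.PiX, (∀ u ∈ U, z * u = u * z) → z = 1) :
    R.Cor218_iii_PiX ∧ R.Cor218_iii_quotient := by
  refine ⟨fun x hx => hts R.PiY R.PiY_open x fun u hu => ?_, ?_⟩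
  · have := hx ⟨u, hu⟩
    change x * u * x⁻¹ = u at this
    calc x * u = x * u * x⁻¹ * x := by group
      _ = u * x := by rw [this]
  · refine R.cor218_iii_quotient_of_slim fun U hU z hz => ?_
    have hUo : IsOpen ((U.map R.PiY.subtype : Subgroup R.PiX) : Set R.PiX) := by
      rw [Subgroup.coe_map]
      exact R.PiY_open.isOpenEmbedding_subtypeVal.isOpenMap _ hU
    exact Subtype.ext (hts _ hUo z (by
      rintro _ ⟨u, hu, rfl⟩
      exact congrArg Subtype.val (hz u hu)))

/-- **Corollary 2.19 (i), subquotients — DISCHARGED modulo temp-slimness of `Π^tp_X` and Cor 2.18 (i).**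
[cite: MochizukiEtTh2009, Cor 2.19(i) p.64] -/
theorem cor219_i_subquotients_of_tempSlim (h218i : R.Cor218_i)
    (hts : ∀ U : Subgroup R.PiX, IsOpen (U : Set R.PiX) →
      ∀ z : R.PiX, (∀ u ∈ U, z * u = u * z) → z = 1) :
    R.Cor219_i_subquotients :=
  R.cor219_i_subquotients_of h218i (R.cor218_iii_of_tempSlim hts).2 (R.cor218_iii_of_tempSlim hts).1

/-- **Corollary 2.19 (i), splittings — DISCHARGED modulo temp-slimness of `Π^tp_X`, Cor 2.18 (i) and
Prop 2.14 (i).** [cite: MochizukiEtTh2009, Cor 2.19(i) p.64] -/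
theorem cor219_i_splittings_of_tempSlim (h218i : R.Cor218_i)
    (hts : ∀ U : Subgroup R.PiX, IsOpen (U : Set R.PiX) →
      ∀ z : R.PiX, (∀ u ∈ U, z * u = u * z) → z = 1)
    (h214i : R.Prop214_i) : R.Cor219_i_splittings :=
  R.cor219_i_splittings_of h218i (R.cor218_iii_of_tempSlim hts).2 (R.cor218_iii_of_tempSlim hts).1
    h214i

end RigidData

end Literature.AnabelianGeometry.EtaleTheta
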